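import Summits.AtomisticToContinuum.Crystallization.Theorems.ChartedZeroExcessLayeredLatticeLiouvilleXC

/-!
# Zero-excess layered lattice Liouville — part XD (lens-2 g59, node «SBGlueB» 1/2): FOUNDATIONS OF THE SB-GLUE ITERATION (u6)

Critic rows 1051/1119 (ORDER OF RECORD for `stmt-AtomisticToContinuum-26636`): leaf (2) `SubWindowBudgetGlueBPG` via parts SBGlueA–D; XC = SBGlueA (the
scalar core).  SBGlueB (parts XD, XE) = the OBJECTS AND TRANSPORT LEMMAS of the Campanato-with-re-charting iteration of part UQ (u6), all PROVED, no statement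
of the column re-typed (memo NODE-g59a-SBGlueB-Design.md of the cell folder has the full architecture).  This file:

* XD.1 CERTIFICATE FLOORS.  The certificates are monotone in their constants (`IsLayeredCrystal.mono`, `IsTameIndexing.mono`, `CoerciveZ.mono`), so (LD)
  `LinearExcessDecayZ` and (HC) `HarmonicComparisonZ` — invoked ONCE at the floor `(κ₀/2, c₀/2, 2C₁)` — serve EVERY re-charted iterate whose certificate stays
  above the floor, with ONE set of constants `(C_L, κ₁, ϱ₁, n₁(ϱ,t))` (`floor_packages`): the «transported-certificate bookkeeping» of NODE-g58f.
* XD.2 LONG BOND CHAINS (`cleanBondPath_long`, `cleanBondPath_real`): in a `1`-clean configuration two sites at distance `≤ 4 + n/2` are joined by `≤ 7 + n`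
  bonds — part TearFree's ladder (`level_succ`, gain `½` per bond beyond radius `4`) continued to all radii.  Needed because hU's tameness constant `C₁` is
  EXISTENTIAL: index neighbours of the model are `3C₁` apart, possibly `> 4`, so T1 `cleanBondPath_one` alone does not join them.
* XD.3 CHAIN PULL-BACK (`isBondChain_pullback`): a bond isomorphism `Ψ : S → H` pulls bond chains of `H` back to bond chains of `S` of the same length.
* XD.4 THE ATOM MAP.  For a bijective registration `Ψ : S → Layered a b w` the atom map `atomOf S Ψ a b w : ℤ²×ℤ → S`, `X ↦ Ψ⁻¹(lsite X)` is a bijection onto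
  `S` with `pullDisp = atomOf − lsite` (`pullDisp_eq_atomOf_sub`); it is the FIXED object of the iteration: re-charting to `(a', b', w')` changes the
  registration to the TRANSPORTED one `transReg … = lsite' ∘ lsite⁻¹ ∘ Ψ` (`transReg_atomOf`, `bijOn_transReg`, `atomOf_transReg`, `pullDisp_transReg`,
  `transReg_sub_self`, functorial `transReg_transReg`).  So the (u6) recursion runs INDEX-SIDE on `φ_j = atomOf − lsite_j` with only the chart moving.
* XD.5 INDEX ↔ SPACE DICTIONARY, metric half: `lsite` is `3C₁`-Lipschitz for the sup metric under `IsTameIndexing C₁` (`norm_lsite_sub_lsite_le`); with XD.2/3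
  every pair of index sites has atoms joined by an `S`-bond chain of `≤ 6C₁·dist X Y + 8` bonds (`exists_atom_chain`), whence `dist_atomOf_le`,
  `image_atomOf_idxBall_subset` and the index-side LOWER MASS BOUND `ncard_idxBall_le_ncard_inter_ball` (no density hypothesis on `S`).
Part XE (SBGlueB 2/2): coherence integrates along these chains (gradient bound of `φ₀`) and tear-free bounds transport to `transReg` ((I4ˢ)'s thresholds).
-/

noncomputable section

open scoped BigOperators InnerProductSpace RealInnerProductSpace
open Set Function Metric
open Summit.AtomisticToContinuum.Crystallization.Theorems.ChartedPlanarOrderRigidityDoor (E3 IsClean)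
open Summit.AtomisticToContinuum.Crystallization.Theorems.ChartedPlanarOrderDensityDichotomy (μS IsSep)
open Summit.AtomisticToContinuum.Crystallization.Theorems.ChartedPlanarOrderCleanScaleP (IsCleanP isCleanP_one_iff)
open Summit.AtomisticToContinuum.Crystallization.Theorems.ChartedPlanarOrderDoorLayered (Layered)

namespace Summit.AtomisticToContinuum.Crystallization.Theorems.ChartedZeroExcessLayeredLatticeLiouville

/-! ### XD.1  Certificate monotonicity and the floor package -/

/-- co-Lipschitz certificates are monotone (downward) in the constant. [this file, g59] -/
theorem IsLayeredCrystal.mono {c c' : ℝ} {a b : E3} {w : ℤ → E3} (h : IsLayeredCrystal c a b w) (hc : c' ≤ c) :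
    IsLayeredCrystal c' a b w :=
  fun x y => (mul_le_mul_of_nonneg_right hc dist_nonneg).trans (h x y)

/-- tameness is monotone (upward) in the constant. [this file, g59] -/
theorem IsTameIndexing.mono {C C' : ℝ} {a b : E3} {w : ℤ → E3} (h : IsTameIndexing C a b w) (hC : C ≤ C') :
    IsTameIndexing C' a b w :=
  ⟨h.1.trans hC, h.2.1.trans hC, fun m => (h.2.2 m).trans hC⟩

/-- coercivity is monotone (downward) in the constant. [this file, g59] -/
theorem CoerciveZ.mono {K : Cell 2 → ℤ → ℤ → (E3 →L[ℝ] E3)} {κ κ' : ℝ} (h : CoerciveZ K κ) (hκ : κ' ≤ κ) : CoerciveZ K κ' :=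
  fun φ hφ E hE => (mul_le_mul_of_nonneg_right hκ (nnFormZ_nonneg φ)).trans (h φ hφ E hE)

/-- the (HC) package at range `ϱ` with constant `κ₁` for ONE layered crystal (the body of `HarmonicComparisonZ` after its constants). [this file, g59] -/
def HCPackage (κ₁ ϱ : ℝ) (a b : E3) (w : ℤ → E3) : Prop :=
  ∀ P : Set (Cell 2 × ℤ), P.Finite → ∀ φ : Cell 2 → ℤ → E3,
    ∃ V : Cell 2 → ℤ → E3, (∀ X : Cell 2 × ℤ, X ∉ P → V X.1 X.2 = φ X.1 X.2) ∧ IsTruncHarmonicZ ϱ a b w V P ∧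
      κ₁ * idxEnergy (φ - V) {X | ∃ Y ∈ P, dist X Y ≤ 1} ≤
        |∑ᶠ X ∈ P, ⟪truncResidual ϱ a b w φ X, φ X.1 X.2 - V X.1 X.2⟫_ℝ|

/-- ★ **THE FLOOR PACKAGE** (transported-certificate bookkeeping of (u6)): given (T), (LD), (HC) and certificate constants `(κ₀, c₀, C₁)`, there are ONE decay
constant `C_L`, ONE comparison constant `κ₁`, ONE range threshold `ϱ₁` and, per `(ϱ, t)`, ONE scale `n₁` serving EVERY layered crystal whose certificate is above
the floor `(κ₀/2, c₀/2, 2C₁)` — in particular every re-charted iterate while the accumulated drift `C_R·Σm ≤ min(c₀, κ₀)/2, ≤ C₁`. [this file, g59] -/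
theorem floor_packages (hT : TailDominationCert) (hLD : LinearExcessDecayZ) (hHC : HarmonicComparisonZ)
    {κ₀ c₀ C₁ : ℝ} (hκ₀ : 0 < κ₀) (hc₀ : 0 < c₀) (hC₁ : 0 < C₁) :
    ∃ CL : ℝ, 1 ≤ CL ∧ ∃ κ₁ : ℝ, 0 < κ₁ ∧ ∃ ϱ₁ : ℝ, 1 ≤ ϱ₁ ∧ ∀ ϱ : ℝ, ϱ₁ ≤ ϱ →
      (∀ (a b : E3) (w : ℤ → E3) (c C κ : ℝ), c₀ / 2 ≤ c → C ≤ 2 * C₁ → κ₀ / 2 ≤ κ →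
          IsLayeredCrystal c a b w → IsTameIndexing C a b w → CoerciveZ (layeredKernel a b w) κ → HCPackage κ₁ ϱ a b w) ∧
      ∀ t : ℝ, 0 < t → t ≤ 1 / 2 → ∃ n₁ : ℝ, 0 < n₁ ∧
        ∀ (a b : E3) (w : ℤ → E3) (c C κ : ℝ), c₀ / 2 ≤ c → C ≤ 2 * C₁ → κ₀ / 2 ≤ κ →
          IsLayeredCrystal c a b w → IsTameIndexing C a b w → CoerciveZ (layeredKernel a b w) κ →
            ModalDecayAt CL ϱ t n₁ a b w ∧ ModeRigidAt CL ϱ n₁ a b w := by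
  have hκ₀' : 0 < κ₀ / 2 := by positivity
  have hc₀' : 0 < c₀ / 2 := by positivity
  have hC₁' : 0 < 2 * C₁ := by positivity
  obtain ⟨CL, hCL, ϱL, hϱL, hL⟩ := hLD hT (κ₀ / 2) hκ₀' (c₀ / 2) hc₀' (2 * C₁) hC₁'
  obtain ⟨κ₁, hκ₁, ϱH, hϱH, hH⟩ := hHC hT (κ₀ / 2) hκ₀' (c₀ / 2) hc₀' (2 * C₁) hC₁'
  refine ⟨CL, hCL, κ₁, hκ₁, max ϱL ϱH, le_max_of_le_left hϱL, fun ϱ hϱ => ⟨?_, ?_⟩⟩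
  · intro a b w c C κ hc hC hκ hcr hti hco
    exact hH ϱ ((le_max_right _ _).trans hϱ) a b w (hcr.mono hc) (hti.mono hC) (hco.mono hκ)
  · intro t ht ht2
    obtain ⟨n₁, hn₁, h⟩ := hL ϱ ((le_max_left _ _).trans hϱ) t ht ht2
    exact ⟨n₁, hn₁, fun a b w c C κ hc hC hκ hcr hti hco => h a b w (hcr.mono hc) (hti.mono hC) (hco.mono hκ)⟩

/-- the drift arithmetic of the floor: while `C_R·μ ≤ c₀/2`, a certificate constant that started at `c₀` and lost `≤ C_R·μ` is above `c₀/2`. [formal bookkeeping] -/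
theorem floor_of_drift {c₀ CR μ x : ℝ} (hx : c₀ - CR * μ ≤ x) (hμ : CR * μ ≤ c₀ / 2) : c₀ / 2 ≤ x := by linarith

/-- … and one that started at `C₁` and gained `≤ C_R·μ ≤ C₁` is below `2C₁`. [formal bookkeeping] -/
theorem ceil_of_drift {C₁ CR μ x : ℝ} (hx : x ≤ C₁ + CR * μ) (hμ : CR * μ ≤ C₁) : x ≤ 2 * C₁ := by linarith

/-! ### XD.2  Long bond chains in clean configurations -/

/-- ★ **LONG CHAINS**: in a `(1/16, 9/10, 1)`-clean configuration every site within `4 + n/2` of `p` reaches `p` in `≤ 7 + n` bonds — T1 `cleanBondPath_one`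
(radius `4`, `7` bonds) continued by the ladder step `level_succ` with rungs `4 + n/2 ↦ 4 + (n+1)/2` (the two endpoint checks of `descend` hold for all radii
`≥ 4`: the greedy first-shell move gains `> ½` per bond there). [folklore; this file, g59] -/
theorem cleanBondPath_long {S : Set E3} (hS : IsCleanP 1 (μS S)) {p : E3} (hp : p ∈ S) :
    ∀ n : ℕ, ∀ y ∈ S, dist p y ≤ 4 + (n : ℝ) / 2 → ∃ (k : ℕ) (z : ℕ → E3), k ≤ 7 + n ∧ IsBondChain S y p k z := by
  intro n
  induction n with
  | zero =>
    intro y hy hd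
    have hd' : dist p y ≤ 4 := by simpa using hd
    obtain ⟨k, z, hk, hz⟩ := cleanBondPath_one S hS y hy p hp hd'
    exact ⟨k, z, by omega, hz⟩
  | succ n ih =>
    have hn : (0 : ℝ) ≤ n := Nat.cast_nonneg n
    have h := level_succ hS (r := 4 + (n : ℝ) / 2) (rn := 4 + ((n : ℝ) + 1) / 2) (n := 7 + n) (by linarith)
      (by nlinarith) (by nlinarith) ih
    intro y hy hd
    have hd' : dist p y ≤ 4 + ((n : ℝ) + 1) / 2 := by push_cast at hd; linarith
    obtain ⟨k, z, hk, hz⟩ := h y hy hd'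
    exact ⟨k, z, by omega, hz⟩

/-- long chains, real-radius form: sites at distance `≤ r` are joined by `≤ 2r + 8` bonds. [this file, g59] -/
theorem cleanBondPath_real {S : Set E3} (hS : IsCleanP 1 (μS S)) {p : E3} (hp : p ∈ S) {y : E3} (hy : y ∈ S) {r : ℝ} (hr : 0 ≤ r)
    (hd : dist p y ≤ r) : ∃ (k : ℕ) (z : ℕ → E3), (k : ℝ) ≤ 2 * r + 8 ∧ IsBondChain S y p k z := by
  have hceil : (⌈2 * r⌉₊ : ℝ) < 2 * r + 1 := Nat.ceil_lt_add_one (by positivity)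
  have hle : r ≤ 4 + (⌈2 * r⌉₊ : ℝ) / 2 := by
    have := Nat.le_ceil (2 * r)
    linarith
  obtain ⟨k, z, hk, hz⟩ := cleanBondPath_long hS hp ⌈2 * r⌉₊ y hy (hd.trans hle)
  refine ⟨k, z, ?_, hz⟩
  have hk' : (k : ℝ) ≤ 7 + (⌈2 * r⌉₊ : ℝ) := by exact_mod_cast hk
  linarith

/-- the length bound of a bond chain: endpoints at distance `≤ (28/25)·k`. [folklore] -/
theorem dist_le_of_isBondChain {S : Set E3} {x p : E3} {k : ℕ} {z : ℕ → E3} (hz : IsBondChain S x p k z) :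
    dist p x ≤ (k : ℝ) * (28 / 25) := by
  obtain ⟨h0, hk, -, hbond⟩ := hz
  have h := dist_le_of_chain hbond
  rwa [hk, h0] at h

/-! ### XD.3  Pulling chains back through a bond isomorphism -/

/-- ★ **CHAIN PULL-BACK**: a bijective bond isomorphism `Ψ : S → H` pulls every bond chain of `H` back to a bond chain of `S` of the same length between the
preimages (the mechanism of `tearFree_backward_of_cleanBondPath`, as a lemma). [folklore; this file, g59] -/
theorem isBondChain_pullback {S H : Set E3} {Ψ : E3 → E3} (hbij : BijOn Ψ S H) (hiso : IsBondIso S Ψ) {x p : E3} {k : ℕ} {z : ℕ → E3}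
    (hz : IsBondChain H x p k z) :
    IsBondChain S (invFunOn Ψ S x) (invFunOn Ψ S p) k (fun i => invFunOn Ψ S (z i)) := by
  obtain ⟨h0, hk, hmem, hbond⟩ := hz
  have hright : ∀ y ∈ H, Ψ (invFunOn Ψ S y) = y := fun y hy => hbij.invOn_invFunOn.2 hy
  have hgS : ∀ y ∈ H, invFunOn Ψ S y ∈ S := fun y hy => hbij.surjOn.mapsTo_invFunOn hy
  refine ⟨by simp [h0], by simp [hk], fun i hi => hgS _ (hmem i hi), fun i hi => ?_⟩
  have hi1 : z (i + 1) ∈ H := hmem (i + 1) hi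
  have hi0 : z i ∈ H := hmem i hi.le
  have hb := hbond i hi
  rw [← hright _ hi1, ← hright _ hi0] at hb
  exact (hiso _ (hgS _ hi0) _ (hgS _ hi1)).2 hb

/-! ### XD.4  The atom map of a registration and the transported registration -/

/-- **THE ATOM MAP** of a registration `Ψ : S → Layered a b w`: the atom `Ψ⁻¹(lsite a b w X)` sitting at the index site `X` — the FIXED object of the (u6)
iteration (re-charting moves `lsite`, never the atoms nor their indexing). [this file, g59] -/
def atomOf (S : Set E3) (Ψ : E3 → E3) (a b : E3) (w : ℤ → E3) (X : Cell 2 × ℤ) : E3 :=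
  invFunOn Ψ S (lsite a b w X.1 X.2)

/-- dictionary: the pulled-back displacement is `atom − model site`. [this file, g59] -/
theorem pullDisp_eq_atomOf_sub (S : Set E3) (Ψ : E3 → E3) (a b : E3) (w : ℤ → E3) (X : Cell 2 × ℤ) :
    pullDisp S Ψ a b w X.1 X.2 = atomOf S Ψ a b w X - lsite a b w X.1 X.2 := rfl

/-- model sites are in the layered set. [formal bookkeeping] -/
theorem lsite_mem_layered (a b : E3) (w : ℤ → E3) (X : Cell 2 × ℤ) : lsite a b w X.1 X.2 ∈ Layered a b w := by
  rw [layered_eq_range]; exact ⟨X, rfl⟩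

section AtomMap

variable {S : Set E3} {Ψ : E3 → E3} {a b : E3} {w : ℤ → E3}

/-- atoms are atoms. [this file, g59] -/
theorem atomOf_mem (hbij : BijOn Ψ S (Layered a b w)) (X : Cell 2 × ℤ) : atomOf S Ψ a b w X ∈ S :=
  hbij.surjOn.mapsTo_invFunOn (lsite_mem_layered a b w X)

/-- the registration sends the atom at `X` to the model site `X`. [this file, g59] -/
theorem apply_atomOf (hbij : BijOn Ψ S (Layered a b w)) (X : Cell 2 × ℤ) : Ψ (atomOf S Ψ a b w X) = lsite a b w X.1 X.2 :=
  hbij.invOn_invFunOn.2 (lsite_mem_layered a b w X)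

/-- the atom map of a bijective registration onto a co-Lipschitz crystal is injective. [this file, g59] -/
theorem atomOf_injective (hbij : BijOn Ψ S (Layered a b w)) {c : ℝ} (hc : 0 < c) (hcr : IsLayeredCrystal c a b w) :
    Injective (atomOf S Ψ a b w) := by
  intro X Y hXY
  have h := congrArg Ψ hXY
  rw [apply_atomOf hbij, apply_atomOf hbij] at h
  exact injective_lsite_of_isLayeredCrystal hc hcr h

/-- … and onto `S`. [this file, g59] -/
theorem exists_atomOf_eq (hbij : BijOn Ψ S (Layered a b w)) {p : E3} (hp : p ∈ S) : ∃ X : Cell 2 × ℤ, atomOf S Ψ a b w X = p := by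
  have hΨp : Ψ p ∈ Layered a b w := hbij.mapsTo hp
  rw [layered_eq_range] at hΨp
  obtain ⟨X, hX⟩ := hΨp
  have hX' : lsite a b w X.1 X.2 = Ψ p := hX
  refine ⟨X, ?_⟩
  unfold atomOf
  rw [hX']
  exact hbij.invOn_invFunOn.1 hp

/-- the atom map preserves the relevant finite sets: the atoms of an index set form a subset of `S` of the same cardinality. [this file, g59] -/
theorem ncard_image_atomOf (hbij : BijOn Ψ S (Layered a b w)) {c : ℝ} (hc : 0 < c) (hcr : IsLayeredCrystal c a b w)
    (B : Set (Cell 2 × ℤ)) : (atomOf S Ψ a b w '' B).ncard = B.ncard :=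
  ncard_image_of_injective B (atomOf_injective hbij hc hcr)

end AtomMap

/-- **THE INDEX MAP** of a co-Lipschitz crystal: the inverse of the (injective) site map on its range. [this file, g59] -/
def idxOf (a b : E3) (w : ℤ → E3) (q : E3) : Cell 2 × ℤ :=
  invFun (fun X : Cell 2 × ℤ => lsite a b w X.1 X.2) q

/-- Auxiliary step (`idxOf lsite`). [formal bookkeeping] -/
theorem idxOf_lsite {a b : E3} {w : ℤ → E3} {c : ℝ} (hc : 0 < c) (hcr : IsLayeredCrystal c a b w) (X : Cell 2 × ℤ) :
    idxOf a b w (lsite a b w X.1 X.2) = X :=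
  leftInverse_invFun (injective_lsite_of_isLayeredCrystal hc hcr) X

/-- Auxiliary step (`lsite idxOf`). [formal bookkeeping] -/
theorem lsite_idxOf {a b : E3} {w : ℤ → E3} {q : E3} (hq : q ∈ Layered a b w) :
    lsite a b w (idxOf a b w q).1 (idxOf a b w q).2 = q := by
  rw [layered_eq_range] at hq
  exact invFun_eq (f := fun X : Cell 2 × ℤ => lsite a b w X.1 X.2) hq

/-- **THE TRANSPORTED REGISTRATION** after re-charting `(a, b, w) ↦ (a', b', w')`: the atom registered at index `X` of the old chart is registered at index `X`
of the new one — `Ψ' = lsite' ∘ lsite⁻¹ ∘ Ψ`. [this file, g59] -/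
def transReg (Ψ : E3 → E3) (a b : E3) (w : ℤ → E3) (a' b' : E3) (w' : ℤ → E3) : E3 → E3 :=
  fun p => lsite a' b' w' (idxOf a b w (Ψ p)).1 (idxOf a b w (Ψ p)).2

section Transport

variable {S : Set E3} {Ψ : E3 → E3} {a b a' b' : E3} {w w' : ℤ → E3} {c c' : ℝ}

/-- the transported registration on atoms: `Ψ' (atom at X) = lsite' X`. [this file, g59] -/
theorem transReg_atomOf (hbij : BijOn Ψ S (Layered a b w)) (hc : 0 < c) (hcr : IsLayeredCrystal c a b w) (X : Cell 2 × ℤ) :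
    transReg Ψ a b w a' b' w' (atomOf S Ψ a b w X) = lsite a' b' w' X.1 X.2 := by
  unfold transReg
  rw [apply_atomOf hbij, idxOf_lsite hc hcr]

/-- the transported registration at an atom `p ∈ S`, through its index `I p = lsite⁻¹ (Ψ p)`: `Ψ p = lsite (I p)` and `Ψ' p = lsite' (I p)`. [this file, g59] -/
theorem lsite_idxOf_apply (hbij : BijOn Ψ S (Layered a b w)) {p : E3} (hp : p ∈ S) :
    lsite a b w (idxOf a b w (Ψ p)).1 (idxOf a b w (Ψ p)).2 = Ψ p :=
  lsite_idxOf (hbij.mapsTo hp)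

/-- ★ the transported registration is again a BIJECTION onto the new layered set. [this file, g59] -/
theorem bijOn_transReg (hbij : BijOn Ψ S (Layered a b w)) (hc : 0 < c) (hcr : IsLayeredCrystal c a b w)
    (hc' : 0 < c') (hcr' : IsLayeredCrystal c' a' b' w') :
    BijOn (transReg Ψ a b w a' b' w') S (Layered a' b' w') := by
  refine ⟨fun p _ => lsite_mem_layered a' b' w' _, fun p hp q hq hpq => ?_, fun y hy => ?_⟩
  · have h1 := injective_lsite_of_isLayeredCrystal hc' hcr' hpq
    have h2 : Ψ p = Ψ q := by
      rw [← lsite_idxOf_apply hbij hp, ← lsite_idxOf_apply hbij hq]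
      exact congrArg (fun X : Cell 2 × ℤ => lsite a b w X.1 X.2) h1
    exact hbij.injOn hp hq h2
  · rw [layered_eq_range] at hy
    obtain ⟨X, rfl⟩ := hy
    exact ⟨atomOf S Ψ a b w X, atomOf_mem hbij X, transReg_atomOf hbij hc hcr X⟩

/-- ★ re-charting does not move the atom map: `atomOf S Ψ' a' b' w' = atomOf S Ψ a b w`. [this file, g59] -/
theorem atomOf_transReg (hbij : BijOn Ψ S (Layered a b w)) (hc : 0 < c) (hcr : IsLayeredCrystal c a b w)
    (hc' : 0 < c') (hcr' : IsLayeredCrystal c' a' b' w') (X : Cell 2 × ℤ) :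
    atomOf S (transReg Ψ a b w a' b' w') a' b' w' X = atomOf S Ψ a b w X := by
  have hinj := (bijOn_transReg hbij hc hcr hc' hcr').injOn
  unfold atomOf
  conv_lhs => rw [← transReg_atomOf (a' := a') (b' := b') (w' := w') hbij hc hcr X]
  exact hinj.leftInvOn_invFunOn (atomOf_mem hbij X)

/-- hence the pulled-back displacement of the transported registration is `atomOf − lsite'` with the OLD atom map. [this file, g59] -/
theorem pullDisp_transReg (hbij : BijOn Ψ S (Layered a b w)) (hc : 0 < c) (hcr : IsLayeredCrystal c a b w)
    (hc' : 0 < c') (hcr' : IsLayeredCrystal c' a' b' w') :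
    pullDisp S (transReg Ψ a b w a' b' w') a' b' w' = fun γ m => atomOf S Ψ a b w (γ, m) - lsite a' b' w' γ m := by
  funext γ m
  rw [show pullDisp S (transReg Ψ a b w a' b' w') a' b' w' γ m = pullDisp S (transReg Ψ a b w a' b' w') a' b' w' (γ, m).1 (γ, m).2 from rfl,
    pullDisp_eq_atomOf_sub, atomOf_transReg hbij hc hcr hc' hcr']

/-- the displacement of the transported registration differs from the old one by the chart difference at the index: for `p ∈ S`,
`Ψ' p − Ψ p = lsite' (I p) − lsite (I p)`. [this file, g59] -/
theorem transReg_sub_self (hbij : BijOn Ψ S (Layered a b w)) {p : E3} (hp : p ∈ S) :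
    transReg Ψ a b w a' b' w' p - Ψ p =
      lsite a' b' w' (idxOf a b w (Ψ p)).1 (idxOf a b w (Ψ p)).2 - lsite a b w (idxOf a b w (Ψ p)).1 (idxOf a b w (Ψ p)).2 := by
  rw [lsite_idxOf_apply hbij hp]; rfl

/-- transport is functorial: transporting `Ψ` to `(a', b', w')` and then to `(a'', b'', w'')` is transporting `Ψ` directly. [this file, g59] -/
theorem transReg_transReg (hc' : 0 < c') (hcr' : IsLayeredCrystal c' a' b' w')
    {a'' b'' : E3} {w'' : ℤ → E3} (p : E3) :
    transReg (transReg Ψ a b w a' b' w') a' b' w' a'' b'' w'' p = transReg Ψ a b w a'' b'' w'' p := by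
  unfold transReg
  rw [idxOf_lsite hc' hcr']

end Transport

/-! ### XD.5  The metric half of the index ↔ space dictionary -/

/-- consecutive-layer control integrates: `‖w (m + k) − w m‖ ≤ C₁·k`. [formal bookkeeping] -/
theorem norm_w_add_sub_w_le {C₁ : ℝ} {a b : E3} {w : ℤ → E3} (hT : IsTameIndexing C₁ a b w) (m : ℤ) :
    ∀ k : ℕ, ‖w (m + k) - w m‖ ≤ C₁ * k := by
  intro k
  induction k with
  | zero => simp
  | succ k ih =>
    have h1 := hT.2.2 (m + k)
    calc ‖w (m + ↑(k + 1)) - w m‖ = ‖(w (m + k + 1) - w (m + k)) + (w (m + k) - w m)‖ := by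
          congr 1; push_cast; rw [← add_assoc]; abel
      _ ≤ ‖w (m + k + 1) - w (m + k)‖ + ‖w (m + k) - w m‖ := norm_add_le _ _
      _ ≤ C₁ + C₁ * k := add_le_add h1 ih
      _ = C₁ * ↑(k + 1) := by push_cast; ring

/-- `‖w m' − w m‖ ≤ C₁·|m' − m|`. [formal bookkeeping] -/
theorem norm_w_sub_w_le {C₁ : ℝ} {a b : E3} {w : ℤ → E3} (hT : IsTameIndexing C₁ a b w) (m m' : ℤ) :
    ‖w m' - w m‖ ≤ C₁ * dist m m' := by
  rcases le_total m m' with h | h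
  · obtain ⟨k, hk⟩ := Int.le.dest h
    rw [← hk, Int.dist_eq]
    have := norm_w_add_sub_w_le hT m k
    have habs : |((m : ℤ) : ℝ) - ((m + (k : ℤ) : ℤ) : ℝ)| = k := by
      push_cast; rw [show (m : ℝ) - (m + k) = -(k : ℝ) by ring, abs_neg]; exact abs_of_nonneg (Nat.cast_nonneg k)
    rw [habs]; exact this
  · obtain ⟨k, hk⟩ := Int.le.dest h
    rw [← hk, Int.dist_eq, ← norm_neg, neg_sub]
    have := norm_w_add_sub_w_le hT m' k
    have habs : |((m' + (k : ℤ) : ℤ) : ℝ) - ((m' : ℤ) : ℝ)| = k := by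
      push_cast; rw [show (m' : ℝ) + k - m' = (k : ℝ) by ring]; exact abs_of_nonneg (Nat.cast_nonneg k)
    rw [habs]; exact this

/-- ★ **`lsite` IS `3C₁`-LIPSCHITZ** for the sup metric of `ℤ² × ℤ` under `IsTameIndexing C₁`. [this file, g59] -/
theorem norm_lsite_sub_lsite_le {C₁ : ℝ} {a b : E3} {w : ℤ → E3} (hT : IsTameIndexing C₁ a b w) (X Y : Cell 2 × ℤ) :
    ‖lsite a b w Y.1 Y.2 - lsite a b w X.1 X.2‖ ≤ 3 * C₁ * dist X Y := by
  have hC : 0 ≤ C₁ := (norm_nonneg a).trans hT.1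
  have hcoord : ∀ j : Fin 2, |((Y.1 j : ℤ) : ℝ) - ((X.1 j : ℤ) : ℝ)| ≤ dist X Y := fun j => by
    rw [abs_sub_comm, ← Int.dist_eq]
    calc dist (X.1 j) (Y.1 j) ≤ dist X.1 Y.1 := dist_le_pi_dist X.1 Y.1 j
      _ ≤ dist X Y := by rw [Prod.dist_eq]; exact le_max_left _ _
  have hlay : dist X.2 Y.2 ≤ dist X Y := by rw [Prod.dist_eq]; exact le_max_right _ _
  have hsplit : lsite a b w Y.1 Y.2 - lsite a b w X.1 X.2 =
      ((((Y.1 0 : ℤ) : ℝ) - ((X.1 0 : ℤ) : ℝ)) • a + ((((Y.1 1 : ℤ) : ℝ) - ((X.1 1 : ℤ) : ℝ)) • b)) + (w Y.2 - w X.2) := by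
    simp only [lsite, sub_smul]; abel
  rw [hsplit]
  calc ‖((((Y.1 0 : ℤ) : ℝ) - ((X.1 0 : ℤ) : ℝ)) • a + ((((Y.1 1 : ℤ) : ℝ) - ((X.1 1 : ℤ) : ℝ)) • b)) + (w Y.2 - w X.2)‖
      ≤ ‖(((Y.1 0 : ℤ) : ℝ) - ((X.1 0 : ℤ) : ℝ)) • a‖ + ‖(((Y.1 1 : ℤ) : ℝ) - ((X.1 1 : ℤ) : ℝ)) • b‖ + ‖w Y.2 - w X.2‖ :=
        (norm_add_le _ _).trans (add_le_add (norm_add_le _ _) le_rfl)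
    _ ≤ dist X Y * C₁ + dist X Y * C₁ + C₁ * dist X Y := by
        rw [norm_smul, norm_smul, Real.norm_eq_abs, Real.norm_eq_abs]
        exact add_le_add (add_le_add (mul_le_mul (hcoord 0) hT.1 (norm_nonneg _) dist_nonneg)
          (mul_le_mul (hcoord 1) hT.2.1 (norm_nonneg _) dist_nonneg))
          ((norm_w_sub_w_le hT X.2 Y.2).trans (mul_le_mul_of_nonneg_left hlay hC))
    _ = 3 * C₁ * dist X Y := by ring

/-- the layered set of a clean chart is `1`-clean in the sense of `IsCleanP` (dictionary `isCleanP_one_iff`). [formal bookkeeping] -/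
theorem isCleanP_one_of_isClean {H : Set E3} (hH : IsClean (μS H)) : IsCleanP 1 (μS H) := (isCleanP_one_iff (μS H)).2 hH

/-- ★ **ATOMS OF NEARBY INDICES ARE BOND-CONNECTED**: for a bijective BOND ISOMORPHISM `Ψ : S → Layered a b w` onto a CLEAN, `C₁`-tame, co-Lipschitz layered
crystal, the atoms at any two index sites `X, Y` are joined by an `S`-bond chain of `≤ 6C₁·dist X Y + 8` bonds (long chains in the model, XD.2, pulled back
by XD.3).  This is what replaces the unavailable «`3C₁ ≤ 4`» — hU's `C₁` is existential. [this file, g59] -/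
theorem exists_atom_chain {S : Set E3} {Ψ : E3 → E3} {a b : E3} {w : ℤ → E3} {C₁ : ℝ}
    (hbij : BijOn Ψ S (Layered a b w)) (hiso : IsBondIso S Ψ) (hH : IsClean (μS (Layered a b w))) (hT : IsTameIndexing C₁ a b w)
    (X Y : Cell 2 × ℤ) :
    ∃ (k : ℕ) (z : ℕ → E3), (k : ℝ) ≤ 6 * C₁ * dist X Y + 8 ∧ IsBondChain S (atomOf S Ψ a b w X) (atomOf S Ψ a b w Y) k z := by
  have hC : 0 ≤ C₁ := (norm_nonneg a).trans hT.1
  have hd : dist (lsite a b w Y.1 Y.2) (lsite a b w X.1 X.2) ≤ 3 * C₁ * dist X Y := by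
    rw [dist_eq_norm]; exact norm_lsite_sub_lsite_le hT X Y
  obtain ⟨k, z, hk, hz⟩ := cleanBondPath_real (isCleanP_one_of_isClean hH) (lsite_mem_layered a b w Y) (lsite_mem_layered a b w X)
    (by positivity) hd
  exact ⟨k, fun i => invFunOn Ψ S (z i), by linarith, isBondChain_pullback hbij hiso hz⟩

/-- ★ **RADIUS COMPARISON, index → space**: `dist (atomOf Y) (atomOf X) ≤ (28/25)·(6C₁·dist X Y + 8)` — uniform along the iteration (the atom map is fixed).
[this file, g59] -/
theorem dist_atomOf_le {S : Set E3} {Ψ : E3 → E3} {a b : E3} {w : ℤ → E3} {C₁ : ℝ}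
    (hbij : BijOn Ψ S (Layered a b w)) (hiso : IsBondIso S Ψ) (hH : IsClean (μS (Layered a b w))) (hT : IsTameIndexing C₁ a b w)
    (X Y : Cell 2 × ℤ) :
    dist (atomOf S Ψ a b w Y) (atomOf S Ψ a b w X) ≤ 28 / 25 * (6 * C₁ * dist X Y + 8) := by
  obtain ⟨k, z, hk, hz⟩ := exists_atom_chain hbij hiso hH hT X Y
  calc dist (atomOf S Ψ a b w Y) (atomOf S Ψ a b w X) ≤ (k : ℝ) * (28 / 25) := dist_le_of_isBondChain hz
    _ ≤ (6 * C₁ * dist X Y + 8) * (28 / 25) := mul_le_mul_of_nonneg_right hk (by norm_num)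
    _ = 28 / 25 * (6 * C₁ * dist X Y + 8) := by ring

/-- ★ **ATOMS OF AN INDEX BALL LIE IN A EUCLIDEAN BALL**: `atomOf '' idxBall X₀ n ⊆ S ∩ ball (atomOf X₀) r` for `r > (28/25)(6C₁ n + 8)`. [this file, g59] -/
theorem image_atomOf_idxBall_subset {S : Set E3} {Ψ : E3 → E3} {a b : E3} {w : ℤ → E3} {C₁ : ℝ}
    (hbij : BijOn Ψ S (Layered a b w)) (hiso : IsBondIso S Ψ) (hH : IsClean (μS (Layered a b w))) (hT : IsTameIndexing C₁ a b w)
    (X₀ : Cell 2 × ℤ) {n r : ℝ} (hr : 28 / 25 * (6 * C₁ * n + 8) < r) :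
    atomOf S Ψ a b w '' idxBall X₀ n ⊆ S ∩ ball (atomOf S Ψ a b w X₀) r := by
  rintro _ ⟨Y, hY, rfl⟩
  have hC : 0 ≤ C₁ := (norm_nonneg a).trans hT.1
  refine ⟨atomOf_mem hbij Y, mem_ball.2 (lt_of_le_of_lt ?_ hr)⟩
  have hY' : dist X₀ Y ≤ n := by rw [dist_comm]; exact hY
  calc dist (atomOf S Ψ a b w Y) (atomOf S Ψ a b w X₀) ≤ 28 / 25 * (6 * C₁ * dist X₀ Y + 8) := dist_atomOf_le hbij hiso hH hT X₀ Y
    _ ≤ 28 / 25 * (6 * C₁ * n + 8) := by gcongr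

/-- ★ **LOWER MASS BOUND, index-side**: a Euclidean ball about an atom that contains the atoms of an index ball has at least `#idxBall` atoms —
`(idxBall X₀ n).ncard ≤ (S ∩ ball (atomOf X₀) r).ncard` for `r > (28/25)(6C₁ n + 8)` (no density hypothesis on `S` needed). [this file, g59] -/
theorem ncard_idxBall_le_ncard_inter_ball {S : Set E3} {Ψ : E3 → E3} {a b : E3} {w : ℤ → E3} {c C₁ δ : ℝ}
    (hbij : BijOn Ψ S (Layered a b w)) (hiso : IsBondIso S Ψ) (hH : IsClean (μS (Layered a b w))) (hT : IsTameIndexing C₁ a b w)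
    (hc : 0 < c) (hcr : IsLayeredCrystal c a b w) (hδ : 0 < δ) (hsep : IsSep δ S)
    (X₀ : Cell 2 × ℤ) {n r : ℝ} (hr : 28 / 25 * (6 * C₁ * n + 8) < r) :
    ((idxBall X₀ n).ncard : ℝ) ≤ ((S ∩ ball (atomOf S Ψ a b w X₀) r).ncard : ℝ) := by
  have hfin : (S ∩ ball (atomOf S Ψ a b w X₀) r).Finite := finite_inter_ball_of_isSep hδ hsep _ r
  rw [← ncard_image_atomOf hbij hc hcr (idxBall X₀ n)]
  exact_mod_cast ncard_le_ncard (image_atomOf_idxBall_subset hbij hiso hH hT X₀ hr) hfin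


end Summit.AtomisticToContinuum.Crystallization.Theorems.ChartedZeroExcessLayeredLatticeLiouville

end
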